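import Literature.Probability.LatticeModels.ScaleFrame
import Literature.Probability.LatticeModels.RandomClusterBoundaryPushing
import Literature.Probability.Percolation.BlockExplorationBasic
import HarnessLib

/-!
# Inner exploration data of a scale frame: decomposition and sandwich tools (proved)

Topic `Literature/Probability/LatticeModels` (trunk `StatMech`, family `crit-ising`); tools for
`ScaleFrameDatum.lean` (Kesten 1986, proof of Lemma (23), run with the exploration-from-inside data
of Basu–Sapozhnikov 2017, §2: the probability of an inner datum is comparable across environments).

* (0) `mem_explEvent_rimWired_forward` / `mem_explEvent_rimWired_backward` — on lattice
  configurations the saturated datum event `{𝒞 = U, 𝒟 = R} ∩ {rim wired through U}` is the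
  intersection of the DECREASING cylinder "every pair from `U` to a vertex off `U ∪ R` is closed" with
  an INCREASING event read on the pairs from `U` into `U ∪ R` ("every vertex of `U` is explored inside
  `U`, and the rim wiring holds").
* (1) `rcMeasure_real_eq_mul_of_closed_inter` — closed-outside domain Markov at that cylinder:
  `φ^B_{⟨E⟩}(Sc closed ∧ P(ω ∩ T)) = φ^B_{⟨E⟩}(Sc closed) · φ^B_{⟨E ∖ Sc⟩}(P(ω ∩ T))`.
* Sandwich tools: `rcMeasure_real_region_le_wired_of_isUpperSet`,
  `rcMeasure_real_wired_le_region_of_isLowerSet` (the conditional-domination bounds of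
  `RandomClusterConditionalDomination.lean` summed over the cylinders off a region, with ONE wired set
  containing the endpoints of all edges off the region), and the frame facts
  `ScaleFrame.setOf_cross_subset_radCross`, `ScaleFrame.le_rad_of_not_mem_edgesWithin`,
  `ScaleFrame.real_cross_le_of_noCrossBound` (RSW clause (ii) of the frame feeds the collar toolkit
  of `RandomClusterBoundaryPushing.lean`).

Everything is proved; no definitions.

## References
* [Kesten1986] H. Kesten, Probab. Theory Related Fields 73 (1986) 369–394, §2, proof of Lemma (23).
* [BasuSapozhnikov2017ECP] D. Basu, A. Sapozhnikov, ECP 22 (2017) no. 26, §2.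
* G. Grimmett, *The Random-Cluster Model*, Springer (2006): Thm. (3.1)(a), Lemma (4.13), (4.14).
-/

noncomputable section

open MeasureTheory Finset SimpleGraph
open Literature.Probability.Percolation (BondConfig openConnIn openGraph explSet explRim explEvent
  PathIn mem_explSet_iff_exists mem_explRim_iff mem_explEvent_iff mem_openConnIn_iff_pathIn
  openGraph_adj subset_explSet openConnIn_explSet_of_mem_explSet openConnIn_mono)

namespace Literature.Probability.LatticeModels

variable {V : Type*}

/-! ### (0) The datum event as a closed cylinder intersected with an increasing event -/

section Decomposition

/-- Raising a configuration on the non-degenerate pairs of `A` preserves `{u ↔ v in A}`. [folklore] -/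
theorem openConnIn_of_agree_ne {ω₁ ω₂ : BondConfig V} {A : Set V} {u v : V}
    (h : ω₁ ∈ openConnIn A u v)
    (hagree : ∀ a ∈ A, ∀ b ∈ A, a ≠ b → s(a, b) ∈ ω₁ → s(a, b) ∈ ω₂) :
    ω₂ ∈ openConnIn A u v := by
  rw [mem_openConnIn_iff_pathIn] at h ⊢
  exact Percolation.BlockExploration.pathIn_of_adj_imp h fun a ha b hb hab => by
    rw [openGraph_adj] at hab ⊢
    exact ⟨hagree a ha b hb hab.2 hab.1, hab.2⟩

/-- **The datum event read on the edges touching the explored set, forward half.** On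
`{𝒞 = U, 𝒟 = R}` with the rim wired through `U`, every vertex of `U` is explored INSIDE `U` and the
rim wiring holds, already for the configuration restricted to any set `T` of pairs containing the open
pairs from `U` into `U ∪ R`. [cite: BasuSapozhnikov2017ECP, §2, paragraph after eq. (2.3)] -/
theorem mem_explEvent_rimWired_forward {In Blk U R : Set V} {ω : BondConfig V} {T : Set (Sym2 V)}
    (hT : ∀ v ∈ U, ∀ w ∈ U ∪ R, v ≠ w → s(v, w) ∈ ω → s(v, w) ∈ T)
    (hω : ω ∈ explEvent In Blk U R)
    (hwired : ∀ r ∈ R, ∀ r₂ ∈ R, ∃ v ∈ U, ∃ v' ∈ U,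
      s(v, r) ∈ ω ∧ s(v', r₂) ∈ ω ∧ ω ∈ openConnIn U v v') :
    (∀ v ∈ U, ∃ u ∈ In, ω ∩ T ∈ openConnIn U u v) ∧
      ∀ r ∈ R, ∀ r₂ ∈ R, ∃ v ∈ U, ∃ v' ∈ U,
        s(v, r) ∈ ω ∩ T ∧ s(v', r₂) ∈ ω ∩ T ∧ ω ∩ T ∈ openConnIn U v v' := by
  obtain ⟨hE, hRim⟩ := mem_explEvent_iff.1 hω
  have key : ∀ a b : V, ω ∈ openConnIn U a b → ω ∩ T ∈ openConnIn U a b := fun a b h =>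
    openConnIn_of_agree_ne h fun x hx y hy hxy hxyω => ⟨hxyω, hT x hx y (Or.inl hy) hxy hxyω⟩
  have hUR : ∀ v ∈ U, ∀ r ∈ R, v ≠ r := by
    rintro v hv r hr rfl
    rw [← hRim] at hr
    exact (mem_explRim_iff.1 hr).1 (by rw [hE]; exact hv)
  refine ⟨fun v hv => ?_, fun r hr r₂ hr₂ => ?_⟩
  · have hv' : v ∈ explSet In Blk ω := by rw [hE]; exact hv
    obtain ⟨-, u, hu, huv⟩ := mem_explSet_iff_exists.1 hv'
    have h := openConnIn_explSet_of_mem_explSet (subset_explSet In Blk ω hu) huv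
    rw [hE] at h
    exact ⟨u, hu, key u v h⟩
  · obtain ⟨v, hv, v', hv', hvr, hv'r, hvv'⟩ := hwired r hr r₂ hr₂
    exact ⟨v, hv, v', hv', ⟨hvr, hT v hv r (Or.inr hr) (hUR v hv r hr) hvr⟩,
      ⟨hv'r, hT v' hv' r₂ (Or.inr hr₂) (hUR v' hv' r₂ hr₂) hv'r⟩, key v v' hvv'⟩

/-- **The datum event read on the edges touching the explored set, backward half.** If
`In ⊆ U ⊆ In ∪ Blk`, `R` misses `In ∪ Blk`, every open pair from `U` to a vertex off `U ∪ R` lies in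
a set `S` of CLOSED pairs, every vertex of `U` is explored inside `U` and the rim wiring holds for the
configuration restricted to `T`, then `{𝒞 = U, 𝒟 = R}` holds with the rim wired through `U` (first
exit of an exploring path from `U`). [cite: BasuSapozhnikov2017ECP, §2, paragraph after eq. (2.3)] -/
theorem mem_explEvent_rimWired_backward {In Blk U R : Set V} {ω : BondConfig V} {S T : Set (Sym2 V)}
    (hIn : In ⊆ U) (hU : U ⊆ In ∪ Blk) (hR : ∀ r ∈ R, r ∉ In ∪ Blk)
    (hS : ∀ v ∈ U, ∀ w ∉ U ∪ R, s(v, w) ∈ ω → s(v, w) ∈ S) (hD : ∀ e ∈ S, e ∉ ω)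
    (h1 : ∀ v ∈ U, ∃ u ∈ In, ω ∩ T ∈ openConnIn U u v)
    (h2 : ∀ r ∈ R, ∀ r₂ ∈ R, ∃ v ∈ U, ∃ v' ∈ U,
      s(v, r) ∈ ω ∩ T ∧ s(v', r₂) ∈ ω ∩ T ∧ ω ∩ T ∈ openConnIn U v v') :
    ω ∈ explEvent In Blk U R ∧ ∀ r ∈ R, ∀ r₂ ∈ R, ∃ v ∈ U, ∃ v' ∈ U,
      s(v, r) ∈ ω ∧ s(v', r₂) ∈ ω ∧ ω ∈ openConnIn U v v' := by
  have closed : ∀ v ∈ U, ∀ w ∉ U ∪ R, s(v, w) ∉ ω := fun v hv w hw h => hD _ (hS v hv w hw h) h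
  have back : ∀ a b : V, ω ∩ T ∈ openConnIn U a b → ω ∈ openConnIn U a b := fun a b h =>
    openConnIn_of_agree_ne h fun x _ y _ _ hxy => hxy.1
  have hE : explSet In Blk ω = U := by
    refine Set.Subset.antisymm (fun v hv => ?_) (fun v hv => ?_)
    · by_contra hvU
      obtain ⟨-, u, hu, huv⟩ := mem_explSet_iff_exists.1 hv
      rw [mem_openConnIn_iff_pathIn] at huv
      obtain ⟨x, y, hx, hy, hyIB, hxy, -⟩ := huv.exit (hIn hu) hvU
      rw [openGraph_adj] at hxy
      exact closed x hx y (fun h => h.elim hy (fun hyR => hR y hyR hyIB)) hxy.1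
    · obtain ⟨u, hu, huv⟩ := h1 v hv
      exact mem_explSet_iff_exists.2 ⟨hU hv, u, hu, openConnIn_mono hU _ _ (back u v huv)⟩
  have hRim : explRim In Blk ω = R := by
    ext w
    rw [mem_explRim_iff, hE]
    constructor
    · rintro ⟨hwU, v, hv, hvw⟩
      by_contra hwR
      exact closed v hv w (fun h => h.elim hwU hwR) hvw
    · intro hw
      obtain ⟨v, hv, -, -, hvw, -, -⟩ := h2 w hw w hw
      exact ⟨fun hwU => hR w hw (hU hwU), v, hv, hvw.1⟩
  refine ⟨⟨hE, hRim⟩, fun r hr r₂ hr₂ => ?_⟩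
  obtain ⟨v, hv, v', hv', hvr, hv'r, hvv'⟩ := h2 r hr r₂ hr₂
  exact ⟨v, hv, v', hv', hvr.1, hv'r.1, back v v' hvv'⟩

end Decomposition

/-! ### (1) Factorisation at the closed cylinder -/

section Factor

/-- Deleting the diagonal pairs of a finite edge set does not change the graph it spans. [folklore] -/
theorem fromEdgeSet_coe_filter_not_isDiag [DecidableEq V] (E : Finset (Sym2 V)) :
    fromEdgeSet (↑(E.filter fun e => ¬ e.IsDiag) : Set (Sym2 V)) = fromEdgeSet (↑E : Set (Sym2 V)) := by
  ext u v
  simp only [fromEdgeSet_adj, Finset.coe_filter, Set.mem_setOf_eq, Sym2.mk_isDiag_iff, Finset.mem_coe]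
  tauto

/-- A geometric step of the scales: `a M^k + a ≤ a M^{k+1}` for `M ≥ 2`, `a ≥ 0`. [folklore] -/
theorem scale_step {a M : ℝ} (ha : 0 ≤ a) (hM : 2 ≤ M) (k : ℕ) :
    a * M ^ k + a ≤ a * M ^ (k + 1) := by
  have hM1 : 1 ≤ M := by linarith
  have hMk : 1 ≤ M ^ k := one_le_pow₀ hM1
  have h0 : 0 ≤ a * M ^ k := mul_nonneg ha (zero_le_one.trans hMk)
  have h2 : a * M ^ k ≤ a * M ^ k * (M - 1) := le_mul_of_one_le_right h0 (by linarith)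
  have h1 : a ≤ a * M ^ k := le_mul_of_one_le_right ha hMk
  calc a * M ^ k + a ≤ a * M ^ k + a * M ^ k * (M - 1) := by linarith
    _ = a * M ^ (k + 1) := by ring

variable [Fintype V] [DecidableEq V]

/-- **Factorisation of a closed cylinder intersected with an event of the remaining edges** (the
closed-outside domain Markov property, Grimmett 2006, Thm. (3.1)(a), in the form used in Kesten 1986,
proof of Lemma (23)): for the graph `⟨E⟩`, a set `Sc` of pairs, the region `U` of the genuine edges of
`E` off `Sc`, a set `T ⊆ U` and an event `A` which on lattice configurations reads "`Sc` is closed and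
`P(ω ∩ T)`", `φ^B_{⟨E⟩}(A) = φ^B_{⟨E⟩}(Sc closed) · φ^B_{⟨U⟩}(P(ω ∩ T))`.
[cite: Kesten1986, proof of Lemma (23)] -/
theorem rcMeasure_real_eq_mul_of_closed_inter : ∀ {V : Type*} [Fintype V] [DecidableEq V] {p q : ℝ}, p ∈ Set.Icc (0 : ℝ) 1 → 0 < q → ∀ (E Sc T U : Finset (Sym2 V)) (B : Set V), (∀ e, e ∈ U ↔ (e ∈ E ∧ ¬ e.IsDiag) ∧ e ∉ Sc) → T ⊆ U → ∀ {A : Set (Literature.Probability.Percolation.BondConfig V)} (P : Set (Sym2 V) → Prop), (∀ ω : Literature.Probability.Percolation.BondConfig V, ω ⊆ (SimpleGraph.fromEdgeSet (E : Set (Sym2 V))).edgeSet → (ω ∈ A ↔ (∀ e ∈ Sc, e ∉ ω) ∧ P (ω ∩ ↑T))) → (Literature.Probability.LatticeModels.rcMeasure (SimpleGraph.fromEdgeSet (E : Set (Sym2 V))) p q B).real A = (Literature.Probability.LatticeModels.rcMeasure (SimpleGraph.fromEdgeSet (E : Set (Sym2 V))) p q B).real {ω | ∀ e ∈ Sc,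 e ∉ ω} * (Literature.Probability.LatticeModels.rcMeasure (SimpleGraph.fromEdgeSet (U : Set (Sym2 V))) p q B).real {ω | P (ω ∩ ↑T)} := by
  intro V _ _ p q hp hq E Sc T U B hUmem hTU A P hA
  classical
  have hU : ∀ i : Fintype (fromEdgeSet (E : Set (Sym2 V))).edgeSet,
      U ⊆ @edgeFinset V (fromEdgeSet (E : Set (Sym2 V))) i := fun i e he =>
    (mem_edgeFinset_fromEdgeSet_iff E i e).2 ((hUmem e).1 he).1
  have hTU' : (↑T : Set (Sym2 V)) ⊆ ↑U := Finset.coe_subset.2 hTU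
  have hinter : ∀ ω : BondConfig V, ω ∩ ↑U ∩ ↑T = ω ∩ ↑T := fun ω => by
    rw [Set.inter_assoc, Set.inter_eq_right.2 hTU']
  -- on lattice configurations: closed on `Sc` iff nothing is open off `U`
  have hcl : ∀ ω : BondConfig V, ω ⊆ (fromEdgeSet (E : Set (Sym2 V))).edgeSet →
      ((∀ e ∈ Sc, e ∉ ω) ↔ ω ∩ (↑U : Set (Sym2 V))ᶜ = ∅) := by
    intro ω hω
    rw [← Set.disjoint_iff_inter_eq_empty, Set.disjoint_compl_right_iff_subset]
    constructor
    · intro h e he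
      have h' := hω he
      rw [edgeSet_fromEdgeSet, Set.mem_sdiff, Finset.mem_coe, Sym2.mem_diagSet] at h'
      exact Finset.mem_coe.2 ((hUmem e).2 ⟨h', fun heS => h e heS he⟩)
    · intro h e heS heω
      exact ((hUmem e).1 (Finset.mem_coe.1 (h heω))).2 heS
  have key := rcMeasure_real_inter_cylinder_empty_eq_mul_fromEdgeSet (fromEdgeSet (E : Set (Sym2 V)))
    hp hq B U (hU _) {ω | P (ω ∩ ↑T)}
  have h1 : (rcMeasure (fromEdgeSet (E : Set (Sym2 V))) p q B).real A =
      (rcMeasure (fromEdgeSet (E : Set (Sym2 V))) p q B).real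
      ({ω | ω ∩ ↑U ∈ {ω : BondConfig V | P (ω ∩ ↑T)}} ∩
        {ω | ω ∩ (↑U : Set (Sym2 V))ᶜ = ∅}) := by
    refine measureReal_congr (rcMeasure_ae_eq_of_forall_subset_edgeSet _ hp hq B fun ω hω => ?_)
    rw [hA ω hω, hcl ω hω]
    simp only [Set.mem_inter_iff, Set.mem_setOf_eq, hinter]
    exact and_comm
  have h2 : (rcMeasure (fromEdgeSet (E : Set (Sym2 V))) p q B).real {ω | ∀ e ∈ Sc, e ∉ ω} =
      (rcMeasure (fromEdgeSet (E : Set (Sym2 V))) p q B).real {ω | ω ∩ (↑U : Set (Sym2 V))ᶜ = ∅} :=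
    measureReal_congr (rcMeasure_ae_eq_of_forall_subset_edgeSet _ hp hq B fun ω hω => hcl ω hω)
  rw [h1, key, h2]


/-! ### Sandwich tools: a region inside an ambient graph, one wired set for all frozen edges -/

/-- **Region versus ambient measure, increasing events**: if `B ⊆ W` and every edge of `G` off the
region `U ⊆ E(G)` has both endpoints in `W`, then for increasing `A`,
`φ^B_G({ω ∩ U ∈ A}) ≤ φ^W_{⟨U⟩}(A)` (`q ≥ 1`): the conditional domination
`rcMeasure_real_inter_cylinder_le_mul_fromEdgeSet` summed over the cylinders off `U`.
[cite: Grimmett2006, Lemma (4.13) and Lemma (4.14)(b)] -/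
theorem rcMeasure_real_region_le_wired_of_isUpperSet (G : SimpleGraph V) [DecidableRel G.Adj]
    {p q : ℝ} (hp : p ∈ Set.Icc (0 : ℝ) 1) (hq : 1 ≤ q) {B W : Set V} (hBW : B ⊆ W)
    (U : Finset (Sym2 V)) (hU : U ⊆ G.edgeFinset) (hoff : ∀ e ∈ G.edgeFinset \ U, ∀ x ∈ e, x ∈ W)
    {A : Set (BondConfig V)} (hA : IsUpperSet A) :
    (rcMeasure G p q B).real {ω | ω ∩ ↑U ∈ A} ≤
      (rcMeasure (fromEdgeSet (U : Set (Sym2 V))) p q W).real A := by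
  have hq0 : 0 < q := one_pos.trans_le hq
  haveI := isProbabilityMeasure_rcMeasure G hp hq0 B
  have h : (rcMeasure G p q B).real ({ω | ω ∩ ↑U ∈ A} ∩ Set.univ) ≤
      (rcMeasure (fromEdgeSet (U : Set (Sym2 V))) p q W).real A *
        (rcMeasure G p q B).real Set.univ :=
    rcMeasure_real_inter_le_mul_of_cylinder_le G hp hq0 B U (fun _ _ _ => Iff.rfl) fun ξ hξ => by
      rw [mul_comm]
      exact rcMeasure_real_inter_cylinder_le_mul_fromEdgeSet G hp hq B U hU _ hBW
        (fun e he x hx => hoff e (hξ (Finset.mem_coe.1 he)) x hx) hA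
  rwa [Set.inter_univ, probReal_univ, mul_one] at h

/-- **Region versus ambient measure, decreasing events**: under the hypotheses of
`rcMeasure_real_region_le_wired_of_isUpperSet`, for decreasing `D`,
`φ^W_{⟨U⟩}(D) ≤ φ^B_G({ω ∩ U ∈ D})` (complements). [cite: Grimmett2006, Lemma (4.13) and Lemma (4.14)(b)] -/
theorem rcMeasure_real_wired_le_region_of_isLowerSet (G : SimpleGraph V) [DecidableRel G.Adj]
    {p q : ℝ} (hp : p ∈ Set.Icc (0 : ℝ) 1) (hq : 1 ≤ q) {B W : Set V} (hBW : B ⊆ W)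
    (U : Finset (Sym2 V)) (hU : U ⊆ G.edgeFinset) (hoff : ∀ e ∈ G.edgeFinset \ U, ∀ x ∈ e, x ∈ W)
    {D : Set (BondConfig V)} (hD : IsLowerSet D) :
    (rcMeasure (fromEdgeSet (U : Set (Sym2 V))) p q W).real D ≤
      (rcMeasure G p q B).real {ω | ω ∩ ↑U ∈ D} := by
  have hq0 : 0 < q := one_pos.trans_le hq
  haveI := isProbabilityMeasure_rcMeasure G hp hq0 B
  haveI := isProbabilityMeasure_rcMeasure (fromEdgeSet (U : Set (Sym2 V))) hp hq0 W
  have h := rcMeasure_real_region_le_wired_of_isUpperSet G hp hq hBW U hU hoff hD.compl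
  have hc : {ω : BondConfig V | ω ∩ ↑U ∈ Dᶜ} = {ω | ω ∩ ↑U ∈ D}ᶜ := rfl
  rw [hc, probReal_compl_eq_one_sub MeasurableSet.of_discrete,
    probReal_compl_eq_one_sub MeasurableSet.of_discrete] at h
  linarith

end Factor

/-! ### Frame facts -/

section Frame

variable [Fintype V] [DecidableEq V]

/-- A radial crossing of `(s, s')` by an open walk of a subgraph `⟨E'⟩`, `E' ⊆ E`, is a radial crossing
of the frame. [cite: Kesten1986, §2 (eq. (28))] -/
theorem ScaleFrame.setOf_cross_subset_radCross (F : ScaleFrame V) {E' : Finset (Sym2 V)}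
    (hE' : E' ⊆ F.E) (s s' : ℝ) :
    {ω : BondConfig V | ∃ (x y : V) (w : (fromEdgeSet (E' : Set (Sym2 V))).Walk x y),
      x ∈ F.inSet s ∧ y ∉ F.inSet s ∪ F.annSet s s' ∧
        (∀ z ∈ w.support, z = x ∨ z = y ∨ z ∈ F.annSet s s') ∧ ∀ e ∈ w.edges, e ∈ ω} ⊆
      F.radCross s s' := by
  have hle : fromEdgeSet (E' : Set (Sym2 V)) ≤ F.graph := fun u v h => by
    rw [fromEdgeSet_adj] at h
    exact (fromEdgeSet_adj _).2 ⟨Finset.mem_coe.2 (hE' (Finset.mem_coe.1 h.1)), h.2⟩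
  rintro ω ⟨x, y, w, hx, hy, hs, he⟩
  refine ⟨x, y, w.mapLe hle, hx, hy, ?_, ?_⟩
  · rw [Walk.support_mapLe_eq_support]; exact hs
  · rw [Walk.edges_mapLe_eq_edges]; exact he

/-- A frame edge not lying below scale `t ≤ Rmax` has its good endpoints of radius `≥ t - η` (frame
continuity). [cite: Kesten1986, §2] -/
theorem ScaleFrame.le_rad_of_not_mem_edgesWithin (F : ScaleFrame V) {t : ℝ} (ht : t ≤ F.Rmax)
    {e : Sym2 V} (he : e ∈ F.E) (heW : e ∉ F.edgesWithin (F.good ∩ {v | F.rad v < t})) {x : V}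
    (hx : x ∈ e) (hxg : x ∈ F.good) : t - F.η ≤ F.rad x := by
  by_contra hlt
  have hlt' := not_le.1 hlt
  refine heW (F.mem_edgesWithin.2 ⟨he, fun y hy => ?_⟩)
  have hxR : F.rad x < F.Rmax := by linarith [F.η_pos]
  obtain ⟨hyg, hyr⟩ := F.adj_good e he x hx y hy hxg hxR
  have := (abs_lt.1 hyr).2
  exact ⟨hyg, by simp only [Set.mem_setOf_eq]; linarith⟩

/-- **The frame's RSW clause (ii) feeds the collar toolkit**: under `NoCrossBound p q c s s'`, for
every `E' ⊆ E` the collar measure (genuine frame edges touching the annulus, outside wired) gives an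
open radial crossing of `(s, s')` by an `⟨E'⟩`-walk probability `≤ 1 - c`.
[cite: Kesten1986, §2 (eq. (28))] -/
theorem ScaleFrame.real_cross_le_of_noCrossBound (F : ScaleFrame V) {p q c s s' : ℝ}
    (hp : p ∈ Set.Icc (0 : ℝ) 1) (hq : 0 < q) (hNC : F.NoCrossBound p q c s s')
    {E' : Finset (Sym2 V)} (hE' : E' ⊆ F.E) :
    (rcMeasure (fromEdgeSet (↑((F.edgesTouching (F.annSet s s')).filter fun e => ¬ e.IsDiag) :
        Set (Sym2 V))) p q (F.annSet s s')ᶜ).real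
      {ω | ∃ (x y : V) (w : (fromEdgeSet (E' : Set (Sym2 V))).Walk x y), x ∈ F.inSet s ∧
        y ∉ F.inSet s ∪ F.annSet s s' ∧ (∀ z ∈ w.support, z = x ∨ z = y ∨ z ∈ F.annSet s s') ∧
          ∀ e ∈ w.edges, e ∈ ω} ≤ 1 - c := by
  rw [rcMeasure_congr_graph (fromEdgeSet_coe_filter_not_isDiag (F.edgesTouching (F.annSet s s')))
    p q _]
  haveI := isProbabilityMeasure_rcMeasure
    (fromEdgeSet (↑(F.edgesTouching (F.annSet s s')) : Set (Sym2 V))) hp hq (F.annSet s s')ᶜ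
  exact (measureReal_mono (F.setOf_cross_subset_radCross hE' s s') (measure_ne_top _ _)).trans hNC

end Frame

end Literature.Probability.LatticeModels

end
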